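/- Free-seat work of WIDTH SEAT 2/3 `ym-line-cbag-p1-w2` (prover-ym-line-cbag-p1-w2-g16-0), route `EguchiKawaiDirectionLadder`
(ideator ym-idea-2, LINE 8), crux `DirectionIncrement` (stmt-QuantumFields-27725): REGISTERED STUB B2 `stub_fubiniIncrement : FubiniIncrement`
BY NAME.  The load-bearing stub B1 `SingleLinkRigidity` stays OPEN; the Yang–Mills mass gap is NOT proved by anything here. -/
import Summits.QuantumFields.YangMills.Theorems.EguchiKawaiDirectionLadderDirectionIncrementDefs
import Summits.QuantumFields.YangMills.Theorems.EguchiKawaiDirectionLadderFubiniIncrement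

/-!
# Route `EguchiKawaiDirectionLadder`, crux `DirectionIncrement` (stmt-QuantumFields-27725): stub B2 `FubiniIncrement` by name

`FubiniIncrement := SingleLinkRigidity → DirectionIncrement` (objects of the registered skeleton, file
`EguchiKawaiDirectionLadderDirectionIncrementDefs`).  The content is `directionIncrement_of_singleLinkRigidity` of
`EguchiKawaiDirectionLadderFubiniIncrement` (Fubini over the last reduced direction via `MeasurableEquiv.piFinSuccAbove`, the action
splitting `S_R^{(d+1)} ≥ S_R^{(d)} + S_R(![U₀, U_d])`, and `{X + Y ≤ t} ⊆ {X ≤ t} ∩ {Y ≤ t}` so that the exponents add); here it is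
re-exported under the registered name, the hypothesis `SingleLinkRigidity` being the spelled-out one with `pairConfig U W = ![U, W]`
folded back.  With this, the crux `DirectionIncrement` hinges on the single open stub B1 `SingleLinkRigidity` (one-matrix rigidity,
`N`-uniform).  Nothing here bears on the Yang–Mills mass gap.
-/

set_option autoImplicit false

noncomputable section

namespace Summit.QuantumFields.YangMills.Theorems.EguchiKawaiDirectionLadder

/-- **STUB B2 of the registered skeleton of crux `DirectionIncrement` (stmt-QuantumFields-27725), proved: `FubiniIncrement`**, i.e.
`SingleLinkRigidity → DirectionIncrement` — by `directionIncrement_of_singleLinkRigidity`.  B1 is NOT proved here. -/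
theorem stub_fubiniIncrement : FubiniIncrement := fun h =>
  directionIncrement_of_singleLinkRigidity h

/-- The crux modulo its load-bearing stub: `SingleLinkRigidity → DirectionIncrement` under the registered names. -/
theorem directionIncrement_of_singleLinkRigidity' (h : SingleLinkRigidity) :
    Summit.QuantumFields.YangMills.Theses.EguchiKawaiDirectionLadder.DirectionIncrement :=
  directionIncrement_of_stubs h stub_fubiniIncrement

end Summit.QuantumFields.YangMills.Theorems.EguchiKawaiDirectionLadder

end
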